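import Literature.NumberTheory.EllipticCurves.ModPImageTransvectionCriterionProofs
import Literature.NumberTheory.EllipticCurves.ArtinExponentThreeTorsionOfTamagawaProofs
import Literature.NumberTheory.EllipticCurves.TamagawaRingEquivProofs
import Literature.NumberTheory.EllipticCurves.BSDConductorProofs
import Literature.NumberTheory.GaloisRepresentations.ModNCyclotomicCharacter
import Summits.BirchSwinnertonDyer.Rank1Residual.Additive.UnramifiedBaseChange
import Summits.BirchSwinnertonDyer.Rank1Residual.Additive.LocIrrOddPrimes
import HarnessLib

/-!
# Route `RamifiedHeegnerPair`, crux U₁ `LeafRankOneUpperAtThree` (stmt-BirchSwinnertonDyer-26022) —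
# an ADDITIVE Tamagawa-`3` carrier forces `ρ̄_{E,3}` ONTO on the Gss2 leaf  ((IMAGE) of line `offhabitat`, UNCONDITIONAL)

HONEST FRAMING. Two unconditional theorems about elliptic curves over `ℚ` (no named-fact hypothesis, no `sorry`); helper file
(`--supports stmt-BirchSwinnertonDyer-26022 --as helper`). They prove the (IMAGE) stub `stub_surjThree_of_additiveCarrier` of the
(unregistered) line `Cruxes/LeafRankOneUpperAtThree/Lines/offhabitat.lean` VERBATIM (second theorem) — the step that shrinks the habitat
complement of the registered line `nscartan` to its two atlas regions. Nothing here closes U₁; BSD is proved for no curve.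
Lead prover bsd-line-rhp-p2 g54, 2026-08-30.

THE ARGUMENT (Serre 1972 §2.4 Prop. 15 read through the tree's transvection criterion). Let `W/ℚ` be globally minimal with
`Addv W 3 ∧ SubGss W 3` (cell `(G) ∧ ss`: the `χ_{−3}`-twist of a curve with good supersingular reduction at `3`), so `E[3]` is
IRREDUCIBLE (`Additive.irr_of_subGss_of_ne_two`, Serre Prop. 12). Let `q ≠ 3` be a prime of additive reduction with `3 ∣ c_q`
(Kodaira IV / IV*). For a prime `𝔓 ∣ q` of `ℤ̄` the inertia group `I_𝔓 ≤ Γ_ℚ` fixes EXACTLY a line of `E[3]`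
(`natCard_fixedSubmodule_inertia_torsionGaloisRep_three_eq`: `#E[3]^{I_𝔓} = 3`), so some `τ ∈ I_𝔓` moves `E[3]`; its fixed space
`ker(τ − 1)` contains the line and is proper, hence IS a line, and `#(E[3]/(τ − 1)E[3]) = 3`. The mod-`3` cyclotomic character is
unramified at `q ≠ 3` (`modNCyclotomicCharacter_eq_one_of_mem_inertia`), so `χ̄₃(τ) = 1`. The tree's
`natCard_quotient_range_sub_id_ne` (irreducible + NOT surjective ⟹ no `σ` with `χ̄₃(σ) = 1` and `#(E[3]/(σ − 1)E[3]) = 3`) now forces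
`ρ̄_{E,3}` to be surjective. [cite: Serre1972, §1.11 Prop. 12; §2.4 Prop. 15] [cite: SilvermanATAEC1994, Cor. IV.9.2(d), Table 4.1]
-/

set_option linter.dupNamespace false
set_option autoImplicit false

noncomputable section

open scoped Classical NumberField

open WeierstrassCurve NumberField IsDedekindDomain IsDedekindDomain.HeightOneSpectrum Rat.HeightOneSpectrum
  Literature.NumberTheory.EllipticCurves Literature.NumberTheory.GaloisRepresentations
  Literature.NumberTheory.EllipticCurves.Rank1Residual
  Summit.BirchSwinnertonDyer.Rank1Residual Summit.BirchSwinnertonDyer.Rank1Residual.Additive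

namespace Summit.BirchSwinnertonDyer.BirchSwinnertonDyer.Theorems.LeafModThreeImage

/-- **An inertial `3`-transvection from an additive Tamagawa-`3` carrier.** For an elliptic curve `W/ℚ` and a prime `q ≠ 3` of
ADDITIVE reduction with `3 ∣ c_q(W)`, there is `τ ∈ Γ_ℚ` with trivial mod-`3` cyclotomic character and `#(E[3]/(τ − 1)E[3]) = 3`
(an element of the inertia group at a prime of `ℤ̄` above `q`: that inertia group fixes exactly a line of `E[3]`
(`natCard_fixedSubmodule_inertia_torsionGaloisRep_three_eq`), and `χ̄₃` is unramified at `q`).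
[cite: SilvermanATAEC1994, Cor. IV.9.2(d), Table 4.1] [cite: Serre1972, §2.4 Prop. 15] -/
theorem exists_cyclotomicTrivial_cokernel_three_of_additiveCarrier (W : WeierstrassCurve ℚ) [W.IsElliptic]
    (q : ℕ) [hq : Fact q.Prime] (hq3 : q ≠ 3) (haddq : Addv W q)
    (hdvd : 3 ∣ (W.baseChange ℚ_[q]).localTamagawaNumber ℤ_[q]) :
    ∃ τ : Field.absoluteGaloisGroup ℚ, modPCyclotomicCharacterZMod ℚ 3 τ = 1 ∧
      Nat.card (geomTorsion W (3 : ℕ) ⧸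
        ((Multiplicative.toAdd (galoisRepTorsion W (3 : ℕ) τ)).toAddMonoidHom -
          AddMonoidHom.id (geomTorsion W (3 : ℕ))).range) = 3 := by
  letI : Module (ZMod 3) (geomTorsion W (3 : ℕ)) := AddSubgroup.torsionBy.zmodModule
  -- the place `v` of `ℚ` at `q`, a prime `𝔓 ∣ v` of `ℤ̄`, and its inertia group
  set v : HeightOneSpectrum (𝓞 ℚ) := (primesEquiv (R := 𝓞 ℚ)).symm ⟨q, hq.out⟩ with hvdef
  have hvq : (primesEquiv v : ℕ) = q := primesEquiv_symm_apply_coe q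
  have haddv : W.HasAdditiveReductionAt v := hasAdditiveReductionAt_of_addv W q haddq
  have h3v' : ((3 : ℕ) : 𝓞 ℚ) ∉ v.asIdeal := by
    intro h3
    have hv3 := (natCast_mem_asIdeal_iff_eq_primesEquiv_symm v Nat.prime_three).mp h3
    have : (primesEquiv v : ℕ) = 3 := by rw [hv3]; simp
    exact hq3 (hvq.symm.trans this)
  have h3v : (3 : 𝓞 ℚ) ∉ v.asIdeal := by simpa using h3v'
  have hdvd' : 3 ∣ (W.baseChange (v.adicCompletion ℚ)).localTamagawaNumber (v.adicCompletionIntegers ℚ) := by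
    rw [← localTamagawaNumber_padic_eq_holds W v q hvq]; exact hdvd
  obtain ⟨𝔓, h𝔓⟩ := v.primesAbove_nonempty
  haveI : 𝔓.IsPrime := h𝔓.1
  set I : Subgroup (Field.absoluteGaloisGroup ℚ) := 𝔓.inertia (Field.absoluteGaloisGroup ℚ) with hIdef
  have h3𝔓 : ((3 : ℕ) : absIntegers (𝓞 ℚ) ℚ) ∉ 𝔓 := by
    intro h
    apply h3v'
    rw [h𝔓.2.over]
    exact Ideal.mem_comap.2 (by rwa [map_natCast])
  -- `#E[3] = 9` and `#E[3]^{I_𝔓} = 3`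
  have h3ne : ((3 : ℕ) : AlgebraicClosure ℚ) ≠ 0 := Nat.cast_ne_zero.mpr (by norm_num)
  have hE : Nat.card (geomTorsion W (3 : ℕ)) = 3 ^ 2 :=
    card_torsionPoints_eq_sq_holds W (AlgebraicClosure ℚ) (n := 3) h3ne
  haveI hEfin : Finite (geomTorsion W (3 : ℕ)) := Nat.finite_of_card_ne_zero (by rw [hE]; norm_num)
  have hfix : Nat.card ((W.torsionGaloisRep 3).fixedSubmodule I) = 3 :=
    W.natCard_fixedSubmodule_inertia_torsionGaloisRep_three_eq haddv h3v hdvd' h𝔓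
  -- some `τ ∈ I_𝔓` moves some `3`-torsion point
  have hmove : ∃ τ ∈ I, ∃ P : geomTorsion W (3 : ℕ), τ • (P : geomPoints W) ≠ P := by
    by_contra hall
    push Not at hall
    have htop : (W.torsionGaloisRep 3).fixedSubmodule I = ⊤ := by
      rw [eq_top_iff]
      intro P _
      exact (W.mem_fixedSubmodule_torsionGaloisRep_iff 3 I P).mpr fun σ hσ ↦ hall σ hσ P
    have h9 : Nat.card ((W.torsionGaloisRep 3).fixedSubmodule I) = 3 ^ 2 := by
      rw [htop, ← hE]
      exact Nat.card_congr (Submodule.topEquiv.toEquiv)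
    rw [hfix] at h9
    norm_num at h9
  obtain ⟨τ, hτ, P, hP⟩ := hmove
  -- a NON-ZERO point of the fixed line
  haveI : Finite ((W.torsionGaloisRep 3).fixedSubmodule I) := Nat.finite_of_card_ne_zero (by rw [hfix]; norm_num)
  haveI : Nontrivial ((W.torsionGaloisRep 3).fixedSubmodule I) :=
    Finite.one_lt_card_iff_nontrivial.mp (by rw [hfix]; norm_num)
  obtain ⟨Q, hQ0⟩ := exists_ne (0 : (W.torsionGaloisRep 3).fixedSubmodule I)
  have hQfix : τ • ((Q : geomTorsion W (3 : ℕ)) : geomPoints W) = (Q : geomTorsion W (3 : ℕ)) :=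
    (W.mem_fixedSubmodule_torsionGaloisRep_iff 3 I Q).mp Q.2 τ hτ
  have hQ0' : (Q : geomTorsion W (3 : ℕ)) ≠ 0 := fun h ↦ hQ0 (by exact_mod_cast h)
  -- the endomorphism `τ - 1` of `E[3]`: its kernel is exactly the line through `Q`
  set f : geomTorsion W (3 : ℕ) →+ geomTorsion W (3 : ℕ) :=
    (Multiplicative.toAdd (galoisRepTorsion W (3 : ℕ) τ)).toAddMonoidHom - AddMonoidHom.id (geomTorsion W (3 : ℕ))
    with hfdef
  have hf : ∀ R : geomTorsion W (3 : ℕ), f R = τ • R - R := fun R ↦ rfl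
  have hQker : (Q : geomTorsion W (3 : ℕ)) ∈ f.ker := by
    rw [AddMonoidHom.mem_ker, hf, sub_eq_zero]
    exact Subtype.ext hQfix
  have hPker : P ∉ f.ker := by
    rw [AddMonoidHom.mem_ker, hf, sub_eq_zero]
    intro h
    exact hP (congrArg Subtype.val h)
  have hker_dvd : Nat.card f.ker ∣ 3 ^ 2 := hE ▸ AddSubgroup.card_addSubgroup_dvd_card f.ker
  have hker : Nat.card f.ker = 3 := by
    obtain ⟨k, hk, hk'⟩ := (Nat.dvd_prime_pow Nat.prime_three).mp hker_dvd
    interval_cases k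
    · -- `#ker = 1`: contradicts `Q ≠ 0`
      exfalso
      rw [pow_zero, AddSubgroup.card_eq_one] at hk'
      rw [hk'] at hQker
      exact hQ0' ((AddSubgroup.mem_bot).mp hQker)
    · simpa using hk'
    · -- `#ker = 9`: contradicts `τ • P ≠ P`
      exfalso
      have htop : f.ker = ⊤ := AddSubgroup.eq_top_of_card_eq f.ker (by rw [hk', hE])
      exact hPker (htop ▸ AddSubgroup.mem_top P)
  -- `#(τ - 1)E[3] = 3` and `#(E[3]/(τ - 1)E[3]) = 3`
  have hrange : Nat.card f.range = 3 := by
    have h1 := AddSubgroup.card_eq_card_quotient_mul_card_addSubgroup f.ker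
    rw [hE, hker, Nat.card_congr (QuotientAddGroup.quotientKerEquivRange f).toEquiv] at h1
    omega
  refine ⟨τ, ?_, ?_⟩
  · -- `χ̄₃` is unramified at `q ≠ 3`
    exact modNCyclotomicCharacter_eq_one_of_mem_inertia (K := ℚ) (N := 3) h3𝔓 hτ
  · show Nat.card (geomTorsion W (3 : ℕ) ⧸ f.range) = 3
    have h2 := AddSubgroup.card_eq_card_quotient_mul_card_addSubgroup f.range
    rw [hE, hrange] at h2
    have h2' : Nat.card (geomTorsion W (3 : ℕ) ⧸ f.range) * 3 = 9 := by rw [← h2]; norm_num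
    omega

/-- **(IMAGE) — an additive Tamagawa-`3` carrier forces `ρ̄₃` onto on the Gss2 leaf** (VERBATIM the signature of
`stub_surjThree_of_additiveCarrier` of `Cruxes/LeafRankOneUpperAtThree/Lines/offhabitat.lean`; the non-CM hypothesis is idle): for `W/ℚ`
globally minimal of cell `(G) ∧ ss` at `3` (`Addv W 3 ∧ SubGss W 3`, so `E[3]` is irreducible — Serre Prop. 12 via
`Additive.irr_of_subGss_of_ne_two`) and `q ≠ 3` a prime of ADDITIVE reduction with `3 ∣ c_q(W)`: `ρ̄_{W,3}` is onto `GL₂(𝔽₃)` — by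
`exists_cyclotomicTrivial_cokernel_three_of_additiveCarrier` and the tree's transvection criterion `natCard_quotient_range_sub_id_ne`
(Serre Prop. 15 read backwards). UNCONDITIONAL. [cite: Serre1972, §1.11 Prop. 12; §2.4 Prop. 15] [cite: SilvermanATAEC1994, Cor. IV.9.2(d), Table 4.1] -/
theorem surjThree_of_additiveCarrier :
    ∀ (W : WeierstrassCurve ℚ) [W.IsElliptic] [W.IsGloballyMinimal], ¬ W.HasCM → Addv W 3 → SubGss W 3 →
      ∀ (q : ℕ) [Fact q.Prime], q ≠ 3 → Addv W q → 3 ∣ (W.baseChange ℚ_[q]).localTamagawaNumber ℤ_[q] → Surj W 3 := by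
  intro W _ _ _hCM hadd hsub q _ hq3 haddq hdvd
  have hirr : W.HasIrreducibleModPGaloisRep 3 := Additive.irr_of_subGss_of_ne_two W 3 (by decide) hadd hsub
  by_contra hns
  obtain ⟨τ, hχ, hcard⟩ := exists_cyclotomicTrivial_cokernel_three_of_additiveCarrier W q hq3 haddq hdvd
  exact W.natCard_quotient_range_sub_id_ne 3 hirr hns τ hχ hcard

end Summit.BirchSwinnertonDyer.BirchSwinnertonDyer.Theorems.LeafModThreeImage

end
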